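import Summits.FinalStateConjecture.FinalStateConjecture.Theorems.EIHFluxBalanceModulatedKerrHandoffOneHoleLeibniz
import Literature.Geometry.Lorentzian.KerrConvergenceProofs
import Mathlib.Analysis.InnerProductSpace.Calculus
import Mathlib.Analysis.Calculus.ContDiff.Deriv

/-!
# Route EIHFluxBalance — `ModulatedKerrHandoff`, stub `stub_oneHoleMatching`: calculus of the retarded clock

Helper file for the crux `stmt-FinalStateConjecture-10167`
(`Summit.FinalStateConjecture.FinalStateConjecture.Theses.EIHFluxBalance.ModulatedKerrHandoff`),
line `photon-rocket-modulation`, stub `stub_oneHoleMatching` (one-hole profile matching).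

The retarded clock `U : E4 → ℝ` of a world-line `ξ : ℝ → E3` of speed `≤ v < 1` is given to the stub
only through its DEFINING EQUATION `x⁰ − U x = ‖x̲ − ξ(U x)‖` and its smoothness off the world-line
(Kinnersley, Phys. Rev. 186 (1969) 1335, §2; Hogan–Puetzfeld arXiv:2007.04685, §2). This file derives
from these two facts alone everything the one-hole matching needs about `U`:

* kinematics of the lab retardation `Δ = x⁰ − U x = ‖x̲ − ξ(U x)‖` versus the lab distance
  `d = ‖x̲ − ξ(x⁰)‖`: `(1 − v) Δ ≤ d ≤ (1 + v) Δ` (`oneHole_retardation_le`, `oneHole_dist_le`);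
* `U` is Lipschitz (constant `2/(1 − v)`), so `{Δ ≠ 0}` is open and `U` is `C^∞` there;
* **the first-order implicit differentiation** `DU = (1 − a)⁻¹ (dt − DN(x̲ − ξ(U)) ∘ S)`,
  `a = DN(x̲ − ξ(U))(ξ′(U))`, `|a| ≤ v` (`N = ‖·‖` on `E3`, `S` = spatial projection), written as an
  identity of functions on `{Δ ≠ 0}` (`oneHole_fderiv_clock_eq`);
* derivative bounds of the Euclidean norm away from the origin, uniform on `{‖z‖ ≥ r}`, by homogeneity
  of `DN` and compactness of a sphere (`exists_ck_fderiv_norm`);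
* **uniform bounds on `D^{≤3} U`** wherever `Δ ≥ r > 0` (`oneHole_clock_ck₁`): `‖D^{k+1}U‖ = ‖Dᵏ(DU)‖`
  and the right-hand side of the first-order formula is a composition of maps with crude pointwise
  `Cᵏ` sizes (`…OneHoleCalculus`, `…OneHoleLeibniz`), so the bound BOOTSTRAPS from order `1` to `3`
  without any explicit higher-derivative formula.
-/

noncomputable section

-- `Summit.<S>.<S>.…` (single-problem summit, D-0017) trips core's duplicate-namespace linter.
set_option linter.dupNamespace false

open Set Filter Function Literature.Geometry.Lorentzian
open scoped Topology ContDiff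

namespace Summit.FinalStateConjecture.FinalStateConjecture.Theorems

namespace OneHole

/-! ### The spatial projection and the time coordinate as operators -/

/-- `‖x̲‖ ≤ ‖x‖`: the spatial projection `S : E4 →L E3` has operator norm `≤ 1`. [folklore] -/
theorem norm_spatial_le : ‖(E4.spatial : E4 →L[ℝ] E3)‖ ≤ 1 := by
  refine ContinuousLinearMap.opNorm_le_bound _ zero_le_one fun x ↦ ?_
  rw [one_mul]
  have h : ‖x‖ ^ 2 = x 0 ^ 2 + ‖E4.spatial x‖ ^ 2 := by
    rw [EuclideanSpace.real_norm_sq_eq, Fin.sum_univ_four, ← E4.spatialNorm, E4.spatialNorm_sq]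
    ring
  nlinarith [norm_nonneg x, norm_nonneg (E4.spatial x), sq_nonneg (x 0)]

/-- The time coordinate `dt = dx⁰ : E4 →L ℝ` has operator norm `≤ 1`. [folklore] -/
theorem norm_dt_le : ‖(EuclideanSpace.proj (0 : Fin 4) : E4 →L[ℝ] ℝ)‖ ≤ 1 := by
  refine ContinuousLinearMap.opNorm_le_bound _ zero_le_one fun x ↦ ?_
  rw [one_mul]
  exact PiLp.norm_apply_le x 0

/-! ### The Euclidean norm of `E3` away from the origin -/

/-- The derivative of the norm has operator norm `≤ 1` (the norm is `1`-Lipschitz). [folklore] -/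
theorem norm_fderiv_norm_le (z : E3) : ‖fderiv ℝ (fun w : E3 ↦ ‖w‖) z‖ ≤ 1 := by
  have h := norm_fderiv_le_of_lipschitz ℝ (f := fun w : E3 ↦ ‖w‖) (x₀ := z) lipschitzWith_one_norm
  simpa using h

/-- The norm of `E3` is `C^∞` on the open set `{z ≠ 0}`. [folklore] -/
theorem contDiffOn_norm_E3 {n : WithTop ℕ∞} : ContDiffOn ℝ n (fun w : E3 ↦ ‖w‖) {z | z ≠ 0} :=
  fun _ hz ↦ (contDiffAt_norm ℝ hz).contDiffWithinAt

/-- **Homogeneity of the derivative of the norm**: `DN(θ z) = DN(z)` for `θ > 0`, `z ≠ 0` (differentiate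
`N(θ w) = θ N(w)`). [folklore] -/
theorem fderiv_norm_smul {θ : ℝ} (hθ : 0 < θ) {z : E3} (hz : z ≠ 0) :
    fderiv ℝ (fun w : E3 ↦ ‖w‖) (θ • z) = fderiv ℝ (fun w : E3 ↦ ‖w‖) z := by
  have hθz : θ • z ≠ 0 := smul_ne_zero hθ.ne' hz
  have hN : HasFDerivAt (fun w : E3 ↦ ‖w‖) (fderiv ℝ (fun w : E3 ↦ ‖w‖) (θ • z)) (θ • z) :=
    ((contDiffAt_norm ℝ hθz (n := 1)).differentiableAt one_ne_zero).hasFDerivAt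
  have h1 : HasFDerivAt (fun w : E3 ↦ ‖θ • w‖)
      ((fderiv ℝ (fun w : E3 ↦ ‖w‖) (θ • z)).comp (θ • ContinuousLinearMap.id ℝ E3)) z :=
    hN.comp z ((ContinuousLinearMap.id ℝ E3).hasFDerivAt.const_smul θ)
  have h2 : HasFDerivAt (fun w : E3 ↦ ‖θ • w‖) (θ • fderiv ℝ (fun w : E3 ↦ ‖w‖) z) z := by
    have h3 : (fun w : E3 ↦ ‖θ • w‖) = fun w ↦ θ * ‖w‖ := by
      funext w; rw [norm_smul, Real.norm_eq_abs, abs_of_pos hθ]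
    rw [h3]
    exact (((contDiffAt_norm ℝ hz (n := 1)).differentiableAt one_ne_zero).hasFDerivAt).const_mul θ
  have h4 := h1.unique h2
  ext w
  have h5 := congrArg (fun L : E3 →L[ℝ] ℝ ↦ L w) h4
  simp only [ContinuousLinearMap.coe_comp, comp_apply, FunLike.coe_smul,
    Pi.smul_apply, ContinuousLinearMap.coe_id', id_eq, map_smul, smul_eq_mul] at h5
  exact mul_left_cancel₀ hθ.ne' h5

/-- **Uniform size of the derivative of the norm on `{‖z‖ ≥ r}`.** For `r > 0` and every order `n` there
is `B` with: the derivatives of orders `≤ n` of `DN` at every `z` with `‖z‖ ≥ r` have norm `≤ B`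
(homogeneity `DN(z) = DN((r/‖z‖) z)` brings `z` to the compact sphere of radius `r`, on which `DN` is
smooth; the scaling only decreases the derivatives since `r/‖z‖ ≤ 1`). [folklore] -/
theorem exists_ck_fderiv_norm (n : ℕ) {r : ℝ} (hr : 0 < r) :
    ∃ B : ℝ, 0 ≤ B ∧ ∀ z : E3, r ≤ ‖z‖ →
      ContDiffAt ℝ n (fderiv ℝ (fun w : E3 ↦ ‖w‖)) z ∧
        ∀ i ≤ n, ‖iteratedFDeriv ℝ i (fderiv ℝ (fun w : E3 ↦ ‖w‖)) z‖ ≤ B := by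
  set O : Set E3 := {z | z ≠ 0} with hO_def
  have hO : IsOpen O := isOpen_ne
  have hDN : ContDiffOn ℝ n (fderiv ℝ (fun w : E3 ↦ ‖w‖)) O :=
    (contDiffOn_norm_E3 (n := (n : ℕ∞) + 1)).fderiv_of_isOpen hO le_rfl
  have hK : IsCompact (Metric.sphere (0 : E3) r) := isCompact_sphere 0 r
  have hKO : Metric.sphere (0 : E3) r ⊆ O := fun z hz h0 ↦ by
    rw [h0, mem_sphere_zero_iff_norm, norm_zero] at hz
    exact hr.ne' hz.symm
  obtain ⟨B, hB0, hB⟩ := exists_forall_ck_of_isCompact hO hDN hK hKO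
  refine ⟨B, hB0, fun z hz ↦ ?_⟩
  have hz0 : z ≠ 0 := fun h ↦ by rw [h, norm_zero] at hz; linarith
  have hzn : 0 < ‖z‖ := norm_pos_iff.mpr hz0
  set θ : ℝ := r / ‖z‖ with hθ_def
  have hθ0 : 0 < θ := div_pos hr hzn
  have hθ1 : θ ≤ 1 := (div_le_one hzn).mpr hz
  have hw : θ • z ∈ Metric.sphere (0 : E3) r := by
    rw [mem_sphere_zero_iff_norm, norm_smul, Real.norm_eq_abs, abs_of_pos hθ0, hθ_def,
      div_mul_cancel₀ _ hzn.ne']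
  have hBw := hB _ hw
  have hcd : ContDiffAt ℝ n (fderiv ℝ (fun w : E3 ↦ ‖w‖)) z := (hDN z hz0).contDiffAt (hO.mem_nhds hz0)
  refine ⟨hcd, fun i hi ↦ ?_⟩
  -- `DN = DN ∘ (θ •)` near `z`
  have hev : (fun w : E3 ↦ (1 : ℝ) • fderiv ℝ (fun w : E3 ↦ ‖w‖) (θ • w)) =ᶠ[𝓝 z]
      fderiv ℝ (fun w : E3 ↦ ‖w‖) := by
    filter_upwards [hO.mem_nhds hz0] with w hw0
    rw [one_smul, fderiv_norm_smul hθ0 hw0]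
  rw [← (hev.iteratedFDeriv ℝ i).eq_of_nhds]
  have hkey := norm_iteratedFDeriv_const_smul_comp_smul_le (fderiv ℝ (fun w : E3 ↦ ‖w‖)) 1 hθ0.ne' z
    (m := i) (hBw.1.of_le (by exact_mod_cast hi))
  refine hkey.trans ?_
  rw [abs_one, one_mul, abs_of_pos hθ0]
  calc θ ^ i * ‖iteratedFDeriv ℝ i (fderiv ℝ (fun w : E3 ↦ ‖w‖)) (θ • z)‖ ≤ 1 * B :=
        mul_le_mul (pow_le_one₀ hθ0.le hθ1) (hBw.2 i hi) (norm_nonneg _) zero_le_one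
    _ = B := one_mul B

/-- Uniform size of `s ↦ (1 − s)⁻¹` on `[-v, v]`, `v < 1`. [folklore] -/
theorem exists_ck_inv_one_sub (n : ℕ) {v : ℝ} (hv : v < 1) :
    ∃ B : ℝ, 0 ≤ B ∧ ∀ s : ℝ, |s| ≤ v →
      ContDiffAt ℝ n (fun s : ℝ ↦ (1 - s)⁻¹) s ∧
        ∀ i ≤ n, ‖iteratedFDeriv ℝ i (fun s : ℝ ↦ (1 - s)⁻¹) s‖ ≤ B := by
  set O : Set ℝ := Iio 1
  have hO : IsOpen O := isOpen_Iio
  have hf : ContDiffOn ℝ n (fun s : ℝ ↦ (1 - s)⁻¹) O := fun s hs ↦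
    ((contDiffAt_const.sub contDiffAt_id).inv (sub_ne_zero.mpr (ne_of_lt hs).symm)).contDiffWithinAt
  obtain ⟨B, hB0, hB⟩ := exists_forall_ck_of_isCompact hO hf isCompact_Icc
    (fun s (hs : s ∈ Icc (-v) v) ↦ (hs.2.trans_lt hv : s < 1))
  exact ⟨B, hB0, fun s hs ↦ hB s ⟨by linarith [(abs_le.mp hs).1], (abs_le.mp hs).2⟩⟩


/-! ### Kinematics of the retarded clock -/

section Clock

variable {ξ : ℝ → E3} {v : ℝ} {Uc : E4 → ℝ}

/-- A world-line with `‖ξ′‖ ≤ v` is `v`-Lipschitz. [folklore] -/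
theorem norm_sub_le_of_deriv_le (hξ : ContDiff ℝ ∞ ξ) (hv0 : 0 ≤ v) (hv : ∀ u, ‖deriv ξ u‖ ≤ v)
    (s t : ℝ) : ‖ξ s - ξ t‖ ≤ v * |s - t| := by
  have hL : LipschitzWith ⟨v, hv0⟩ ξ :=
    lipschitzWith_of_nnnorm_deriv_le (hξ.differentiable (by simp)) fun u ↦ by
      change ‖deriv ξ u‖₊ ≤ (⟨v, hv0⟩ : NNReal)
      exact_mod_cast hv u
  have h := hL.dist_le_mul s t
  rwa [dist_eq_norm, Real.dist_eq] at h

/-- The lab retardation `Δ = x⁰ − U x` is nonnegative (it is a norm; Kinnersley 1969, §2).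
[folklore] -/
theorem retardation_nonneg (hclock : ∀ x, x 0 - Uc x = ‖E4.spatial x - ξ (Uc x)‖) (x : E4) :
    0 ≤ x 0 - Uc x := by
  rw [hclock x]; exact norm_nonneg _

/-- **Lab distance versus retardation, upper**: `d = ‖x̲ − ξ(x⁰)‖ ≤ (1 + v) Δ` (the centre moves at most
`v Δ` during the retardation; Kinnersley 1969, §2). [folklore] -/
theorem dist_le_retardation (hξ : ContDiff ℝ ∞ ξ) (hv0 : 0 ≤ v) (hv : ∀ u, ‖deriv ξ u‖ ≤ v)
    (hclock : ∀ x, x 0 - Uc x = ‖E4.spatial x - ξ (Uc x)‖) (x : E4) :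
    ‖E4.spatial x - ξ (x 0)‖ ≤ (1 + v) * (x 0 - Uc x) := by
  have hΔ := retardation_nonneg hclock x
  have h1 := norm_sub_le_of_deriv_le hξ hv0 hv (Uc x) (x 0)
  rw [abs_sub_comm, abs_of_nonneg hΔ] at h1
  calc ‖E4.spatial x - ξ (x 0)‖ ≤ ‖E4.spatial x - ξ (Uc x)‖ + ‖ξ (Uc x) - ξ (x 0)‖ :=
        norm_sub_le_norm_sub_add_norm_sub _ _ _
    _ ≤ (x 0 - Uc x) + v * (x 0 - Uc x) := by rw [← hclock x]; exact add_le_add le_rfl h1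
    _ = (1 + v) * (x 0 - Uc x) := by ring

/-- **Lab distance versus retardation, lower**: `(1 − v) Δ ≤ d` (Kinnersley 1969, §2). [folklore] -/
theorem retardation_le_dist (hξ : ContDiff ℝ ∞ ξ) (hv0 : 0 ≤ v) (hv : ∀ u, ‖deriv ξ u‖ ≤ v)
    (hclock : ∀ x, x 0 - Uc x = ‖E4.spatial x - ξ (Uc x)‖) (x : E4) :
    (1 - v) * (x 0 - Uc x) ≤ ‖E4.spatial x - ξ (x 0)‖ := by
  have hΔ := retardation_nonneg hclock x
  have h1 := norm_sub_le_of_deriv_le hξ hv0 hv (x 0) (Uc x)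
  rw [abs_of_nonneg hΔ] at h1
  have h2 : ‖E4.spatial x - ξ (Uc x)‖ ≤ ‖E4.spatial x - ξ (x 0)‖ + ‖ξ (x 0) - ξ (Uc x)‖ :=
    norm_sub_le_norm_sub_add_norm_sub _ _ _
  rw [← hclock x] at h2
  nlinarith

/-- **The retarded clock is Lipschitz** with constant `2/(1 − v)`: if `U x > U y` then during
`[U y, U x]` the centre moves by at most `v (U x − U y)`, so the two clock equations give
`(1 − v)(U x − U y) ≤ |x⁰ − y⁰| + ‖x̲ − y̲‖ ≤ 2‖x − y‖` (Kinnersley 1969, §2). [folklore] -/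
theorem abs_clock_sub_le (hξ : ContDiff ℝ ∞ ξ) (hv0 : 0 ≤ v) (hv1 : v < 1) (hv : ∀ u, ‖deriv ξ u‖ ≤ v)
    (hclock : ∀ x, x 0 - Uc x = ‖E4.spatial x - ξ (Uc x)‖) (x y : E4) :
    |Uc x - Uc y| ≤ 2 / (1 - v) * ‖x - y‖ := by
  -- one-sided estimate, then symmetry
  have key : ∀ x y : E4, (1 - v) * (Uc x - Uc y) ≤ 2 * ‖x - y‖ := by
    intro x y
    rcases le_or_gt (Uc x) (Uc y) with hle | hgt
    · nlinarith [norm_nonneg (x - y)]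
    · have h1 := norm_sub_le_of_deriv_le hξ hv0 hv (Uc x) (Uc y)
      rw [abs_of_pos (sub_pos.mpr hgt)] at h1
      have h2 : ‖E4.spatial y - ξ (Uc y)‖ ≤ ‖E4.spatial x - ξ (Uc x)‖ +
          ‖E4.spatial (x - y)‖ + ‖ξ (Uc x) - ξ (Uc y)‖ := by
        have : E4.spatial y - ξ (Uc y) =
            (E4.spatial x - ξ (Uc x)) - E4.spatial (x - y) + (ξ (Uc x) - ξ (Uc y)) := by
          rw [map_sub]; abel
        rw [this]
        exact (norm_add_le _ _).trans (add_le_add (norm_sub_le _ _) le_rfl)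
      rw [← hclock x, ← hclock y] at h2
      have h3 : ‖E4.spatial (x - y)‖ ≤ ‖x - y‖ :=
        (E4.spatial.le_opNorm _).trans (by nlinarith [norm_spatial_le, norm_nonneg (x - y)])
      have h4 : x 0 - y 0 ≤ ‖x - y‖ := by
        have := PiLp.norm_apply_le (x - y) 0
        simp only [PiLp.sub_apply, Real.norm_eq_abs] at this
        exact (le_abs_self _).trans this
      nlinarith
  have hx := key x y
  have hy := key y x
  rw [norm_sub_rev y x] at hy
  have h1v : 0 < 1 - v := by linarith
  have ex : Uc x - Uc y ≤ 2 / (1 - v) * ‖x - y‖ := by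
    rw [div_mul_eq_mul_div, le_div_iff₀ h1v]; linarith
  have ey : Uc y - Uc x ≤ 2 / (1 - v) * ‖x - y‖ := by
    rw [div_mul_eq_mul_div, le_div_iff₀ h1v]; linarith
  exact abs_sub_le_iff.mpr ⟨ex, ey⟩

/-- The retarded clock is continuous. [folklore] -/
theorem continuous_clock (hξ : ContDiff ℝ ∞ ξ) (hv0 : 0 ≤ v) (hv1 : v < 1) (hv : ∀ u, ‖deriv ξ u‖ ≤ v)
    (hclock : ∀ x, x 0 - Uc x = ‖E4.spatial x - ξ (Uc x)‖) : Continuous Uc := by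
  have hL : LipschitzWith ⟨2 / (1 - v), by positivity⟩ Uc := by
    refine LipschitzWith.of_dist_le_mul fun x y ↦ ?_
    rw [Real.dist_eq, dist_eq_norm]
    exact abs_clock_sub_le hξ hv0 hv1 hv hclock x y
  exact hL.continuous

/-- Off the world-line means positive retardation: `{x̲ ≠ ξ(U x)} = {x⁰ − U x ≠ 0}`. [folklore] -/
theorem setOf_spatial_ne_eq (hclock : ∀ x, x 0 - Uc x = ‖E4.spatial x - ξ (Uc x)‖) :
    {x : E4 | E4.spatial x ≠ ξ (Uc x)} = {x : E4 | x 0 - Uc x ≠ 0} := by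
  ext x
  simp only [mem_setOf_eq]
  rw [hclock x, Ne, Ne, norm_eq_zero, sub_eq_zero]

/-- The set of positive retardation `{x⁰ − U x ≠ 0}` is open. [folklore] -/
theorem isOpen_retardation_ne (hξ : ContDiff ℝ ∞ ξ) (hv0 : 0 ≤ v) (hv1 : v < 1)
    (hv : ∀ u, ‖deriv ξ u‖ ≤ v) (hclock : ∀ x, x 0 - Uc x = ‖E4.spatial x - ξ (Uc x)‖) :
    IsOpen {x : E4 | x 0 - Uc x ≠ 0} :=
  isOpen_ne_fun ((PiLp.continuous_apply 2 _ 0).sub (continuous_clock hξ hv0 hv1 hv hclock))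
    continuous_const

/-- The retarded clock is `C^∞` at every point of positive retardation. [folklore] -/
theorem contDiffAt_clock (hξ : ContDiff ℝ ∞ ξ) (hv0 : 0 ≤ v) (hv1 : v < 1)
    (hv : ∀ u, ‖deriv ξ u‖ ≤ v) (hclock : ∀ x, x 0 - Uc x = ‖E4.spatial x - ξ (Uc x)‖)
    (hU : ContDiffOn ℝ ∞ Uc {x : E4 | E4.spatial x ≠ ξ (Uc x)}) {x : E4} (hx : x 0 - Uc x ≠ 0)
    {n : WithTop ℕ∞} (hn : n ≤ ∞) : ContDiffAt ℝ n Uc x := by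
  rw [setOf_spatial_ne_eq hclock] at hU
  exact ((hU x hx).contDiffAt ((isOpen_retardation_ne hξ hv0 hv1 hv hclock).mem_nhds hx)).of_le hn

/-! ### First-order implicit differentiation of the clock equation -/

/-- Bookkeeping: `f ∘ (U′ ⊗ w) = f(w) • U′` for a covector `f`. [folklore] -/
theorem comp_smulRight (f : E3 →L[ℝ] ℝ) (U' : E4 →L[ℝ] ℝ) (w : E3) :
    f.comp (U'.smulRight w) = f w • U' := by
  ext y
  simp [mul_comm]

/-- **The derivative of the retarded clock.** At a point of positive retardation,
`DU = (1 − a)⁻¹ • (dt − DN(x̲ − ξ(U x)) ∘ S)` with `a = DN(x̲ − ξ(U x))(ξ′(U x))`, where `N` is the norm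
of `E3`, `S` the spatial projection and `dt = dx⁰` (differentiate `x⁰ − U x = N(x̲ − ξ(U x))` and solve;
`1 − a ≥ 1 − v > 0`). Kinnersley 1969, §2, eq. (2.6) (`k_μ = ∂_μ u`). [folklore] -/
theorem hasFDerivAt_clock (hξ : ContDiff ℝ ∞ ξ) (hv0 : 0 ≤ v) (hv1 : v < 1)
    (hv : ∀ u, ‖deriv ξ u‖ ≤ v) (hclock : ∀ x, x 0 - Uc x = ‖E4.spatial x - ξ (Uc x)‖)
    (hU : ContDiffOn ℝ ∞ Uc {x : E4 | E4.spatial x ≠ ξ (Uc x)}) {x : E4} (hx : x 0 - Uc x ≠ 0) :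
    |fderiv ℝ (fun w : E3 ↦ ‖w‖) (E4.spatial x - ξ (Uc x)) (deriv ξ (Uc x))| ≤ v ∧
    HasFDerivAt Uc
      ((1 - fderiv ℝ (fun w : E3 ↦ ‖w‖) (E4.spatial x - ξ (Uc x)) (deriv ξ (Uc x)))⁻¹ •
        ((EuclideanSpace.proj (0 : Fin 4) : E4 →L[ℝ] ℝ) -
          (fderiv ℝ (fun w : E3 ↦ ‖w‖) (E4.spatial x - ξ (Uc x))).comp E4.spatial)) x := by
  set z : E3 := E4.spatial x - ξ (Uc x) with hz_def
  set DN : E3 →L[ℝ] ℝ := fderiv ℝ (fun w : E3 ↦ ‖w‖) z with hDN_def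
  set a : ℝ := DN (deriv ξ (Uc x)) with ha_def
  have hz : z ≠ 0 := by
    intro h
    apply hx
    rw [hclock x, ← hz_def, h, norm_zero]
  -- `|a| ≤ v`
  have ha : |a| ≤ v := by
    have h1 := DN.le_opNorm (deriv ξ (Uc x))
    rw [Real.norm_eq_abs] at h1
    exact h1.trans ((mul_le_mul (norm_fderiv_norm_le z) (hv _) (norm_nonneg _) zero_le_one).trans
      (by rw [one_mul]))
  refine ⟨ha, ?_⟩
  have h1a : 1 - a ≠ 0 := by
    have := (abs_le.mp ha).2
    linarith
  -- differentiate both sides of the clock equation at `x`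
  have hUd : DifferentiableAt ℝ Uc x :=
    (contDiffAt_clock hξ hv0 hv1 hv hclock hU hx (le_refl _)).differentiableAt (by simp)
  set U' : E4 →L[ℝ] ℝ := fderiv ℝ Uc x with hU'_def
  have hUc : HasFDerivAt Uc U' x := hUd.hasFDerivAt
  have hlhs : HasFDerivAt (fun y : E4 ↦ y 0 - Uc y)
      ((EuclideanSpace.proj (0 : Fin 4) : E4 →L[ℝ] ℝ) - U') x :=
    ((EuclideanSpace.proj (0 : Fin 4) : E4 →L[ℝ] ℝ).hasFDerivAt).sub hUc
  have hξd : HasFDerivAt (fun y : E4 ↦ ξ (Uc y)) (U'.smulRight (deriv ξ (Uc x))) x := by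
    have h := ((hξ.differentiable (by simp)) (Uc x)).hasDerivAt.hasFDerivAt.comp x hUc
    have he : (ContinuousLinearMap.toSpanSingleton ℝ (deriv ξ (Uc x))).comp U' =
        U'.smulRight (deriv ξ (Uc x)) := by
      ext y; simp [ContinuousLinearMap.toSpanSingleton_apply]
    rw [he] at h
    exact h
  have hZ : HasFDerivAt (fun y : E4 ↦ E4.spatial y - ξ (Uc y))
      ((E4.spatial : E4 →L[ℝ] E3) - U'.smulRight (deriv ξ (Uc x))) x :=
    E4.spatial.hasFDerivAt.sub hξd
  have hN : HasFDerivAt (fun w : E3 ↦ ‖w‖) DN z :=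
    ((contDiffAt_norm ℝ hz (n := 1)).differentiableAt one_ne_zero).hasFDerivAt
  have hrhs : HasFDerivAt (fun y : E4 ↦ ‖E4.spatial y - ξ (Uc y)‖)
      (DN.comp ((E4.spatial : E4 →L[ℝ] E3) - U'.smulRight (deriv ξ (Uc x)))) x :=
    hN.comp x hZ
  have hfun : (fun y : E4 ↦ y 0 - Uc y) = fun y : E4 ↦ ‖E4.spatial y - ξ (Uc y)‖ := funext hclock
  rw [hfun] at hlhs
  have heq := hlhs.unique hrhs
  rw [ContinuousLinearMap.comp_sub, comp_smulRight] at heq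
  -- solve the linear equation `dt − U′ = DN ∘ S − a • U′`
  have hsol : U' = (1 - a)⁻¹ •
      ((EuclideanSpace.proj (0 : Fin 4) : E4 →L[ℝ] ℝ) - DN.comp E4.spatial) := by
    ext y
    have h3 := congrArg (fun L : E4 →L[ℝ] ℝ ↦ L y) heq
    simp only [FunLike.coe_sub, Pi.sub_apply, ContinuousLinearMap.coe_comp,
      comp_apply, FunLike.coe_smul, Pi.smul_apply, smul_eq_mul] at h3 ⊢
    rw [← ha_def] at h3
    rw [eq_inv_mul_iff_mul_eq₀ h1a]
    have h4 : (EuclideanSpace.proj (0 : Fin 4) : E4 →L[ℝ] ℝ) y = y 0 := rfl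
    rw [h4] at h3 ⊢
    linarith
  rw [← hsol]
  exact hUc

/-- **The derivative of the retarded clock as an identity at every point of positive retardation**
(`HasFDerivAt.fderiv` of `hasFDerivAt_clock`). Kinnersley 1969, §2. [folklore] -/
theorem fderiv_clock_eq (hξ : ContDiff ℝ ∞ ξ) (hv0 : 0 ≤ v) (hv1 : v < 1)
    (hv : ∀ u, ‖deriv ξ u‖ ≤ v) (hclock : ∀ x, x 0 - Uc x = ‖E4.spatial x - ξ (Uc x)‖)
    (hU : ContDiffOn ℝ ∞ Uc {x : E4 | E4.spatial x ≠ ξ (Uc x)}) {x : E4} (hx : x 0 - Uc x ≠ 0) :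
    fderiv ℝ Uc x =
      (1 - fderiv ℝ (fun w : E3 ↦ ‖w‖) (E4.spatial x - ξ (Uc x)) (deriv ξ (Uc x)))⁻¹ •
        ((EuclideanSpace.proj (0 : Fin 4) : E4 →L[ℝ] ℝ) -
          (fderiv ℝ (fun w : E3 ↦ ‖w‖) (E4.spatial x - ξ (Uc x))).comp E4.spatial) :=
  (hasFDerivAt_clock hξ hv0 hv1 hv hclock hU hx).2.fderiv

/-- **`‖DU‖ ≤ 2/(1 − v)`** at every point of positive retardation (`|a| ≤ v`, `‖dt‖, ‖DN‖, ‖S‖ ≤ 1`).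
Kinnersley 1969, §2. [folklore] -/
theorem norm_fderiv_clock_le (hξ : ContDiff ℝ ∞ ξ) (hv0 : 0 ≤ v) (hv1 : v < 1)
    (hv : ∀ u, ‖deriv ξ u‖ ≤ v) (hclock : ∀ x, x 0 - Uc x = ‖E4.spatial x - ξ (Uc x)‖)
    (hU : ContDiffOn ℝ ∞ Uc {x : E4 | E4.spatial x ≠ ξ (Uc x)}) {x : E4} (hx : x 0 - Uc x ≠ 0) :
    ‖fderiv ℝ Uc x‖ ≤ 2 / (1 - v) := by
  obtain ⟨ha, -⟩ := hasFDerivAt_clock hξ hv0 hv1 hv hclock hU hx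
  rw [fderiv_clock_eq hξ hv0 hv1 hv hclock hU hx, norm_smul, Real.norm_eq_abs, abs_inv]
  set a := fderiv ℝ (fun w : E3 ↦ ‖w‖) (E4.spatial x - ξ (Uc x)) (deriv ξ (Uc x))
  have h1 : 1 - v ≤ |1 - a| := by
    have := (abs_le.mp ha).2
    rw [abs_of_pos (by linarith)]
    linarith
  have h2 : ‖(EuclideanSpace.proj (0 : Fin 4) : E4 →L[ℝ] ℝ) -
      (fderiv ℝ (fun w : E3 ↦ ‖w‖) (E4.spatial x - ξ (Uc x))).comp E4.spatial‖ ≤ 2 := by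
    refine (norm_sub_le _ _).trans ?_
    have h3 := (ContinuousLinearMap.opNorm_comp_le
      (fderiv ℝ (fun w : E3 ↦ ‖w‖) (E4.spatial x - ξ (Uc x))) E4.spatial).trans
      (mul_le_mul (norm_fderiv_norm_le _) norm_spatial_le (norm_nonneg _) zero_le_one)
    linarith [norm_dt_le]
  have h1v : 0 < 1 - v := by linarith
  calc |1 - a|⁻¹ * _ ≤ (1 - v)⁻¹ * 2 :=
        mul_le_mul (inv_anti₀ h1v h1) h2 (norm_nonneg _) (inv_nonneg.mpr h1v.le)
    _ = 2 / (1 - v) := by rw [inv_mul_eq_div]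

end Clock

end OneHole

/-- Registered sub-goal form (stub `oneHole_abs_clock_sub_le` of the crux item) of
`OneHole.abs_clock_sub_le`: the retarded clock of a world-line of speed `≤ v < 1` is Lipschitz with
constant `2/(1 − v)` (Kinnersley 1969, §2). [folklore] -/
theorem oneHole_abs_clock_sub_le : open Literature.Geometry.Lorentzian in ∀ {ξ : ℝ → E3} {v : ℝ} {Uc : E4 → ℝ}, ContDiff ℝ ((⊤ : ℕ∞) : WithTop ℕ∞) ξ → 0 ≤ v → v < 1 → (∀ u, ‖deriv ξ u‖ ≤ v) → (∀ x, x 0 - Uc x = ‖E4.spatial x - ξ (Uc x)‖) → ∀ x y : E4, |Uc x - Uc y| ≤ 2 / (1 - v) * ‖x - y‖ :=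
  fun hξ hv0 hv1 hv hclock x y ↦ OneHole.abs_clock_sub_le hξ hv0 hv1 hv hclock x y

end Summit.FinalStateConjecture.FinalStateConjecture.Theorems

end
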